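import Summits.PneNP.PneNP.Theorems.NegLimitedAmplifiedWindowAmpSums
import Summits.PneNP.PneNP.Theorems.NegLimitedAmplifiedWindowBiasMoments
import Mathlib
import HarnessLib

/-!
# Amplified critical window — stub A, part A7 `RM3BiasDecay` (O'Donnell's expected bias of `RM3_d`)
(cell pnp-ideate, rung F-N1/p3, ROUND-12; line `amplified-window` on item stmt-PneNP-19860, stub A
`MonotoneAmplification`; typed part `Amp.RM3BiasDecay` of `NegLimitedAmplifiedWindowAmpDefs.lean`, blueprint
HOME/pnp-ideate-p3/r12/BLUEPRINT-A.md §8)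

`rm3BiasDecay_holds : RM3BiasDecay` — with `α := log₃(16/13)/2 ∈ (0, ½]`, for every `0 < p ≤ 1` there is
`K₁ > 0` with `expAbsBias d p ≤ K₁·(3^d)^{−α}` for all `d`.  Assembly of the landed pieces:
* SEMANTICS (`rhoBias_eq_rbias`): the true restricted bias `2^{-3^d} Σ_z sgn RM3_d(ρ ⊕ z)` obeys the node rule
  `(b₀+b₁+b₂ − b₀b₁b₂)/2` (`sgn_maj3`; the `z`-average factorises over the three subtrees), hence equals the
  recursively computed `rbias d ρ` of `NegLimitedAmplifiedWindowBiasMoments.lean`; `cbias_eq_rhoBias`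
  identifies p3's `cbias (recMaj3 d) S v` with it at `ρ = toRestr S v`;
* RE-INDEXING (`expAbsBias_eq_sum_rwt`): `(S, v) ↦ ρ` is `2^{|S|}`-to-`1` with weights `(p/2)^{|S|}((1−p)/2)^{3^d−|S|}`
  summing to `rwt p ρ` — via the generic pushforward `Amp.sum_bw_mul_comp` on `W → Bool × Bool`;
* DECAY: `sum_rwt_mul_abs_rbias_le` (`E|bias| ≤ √q_d`), `qMoment_eq_biasSeq`, `biasSeq_decay`
  (`q_d ≤ C(p)(13/16)^d`) and `√((13/16)^d) = (3^d)^{−α}` (`sqrt_pow_eq_rpow`).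

References: R. O'Donnell, *Hardness amplification within NP*, JCSS 69 (2004), §4 (expected bias of recursive
majority) [ODonnell2004].

HONEST FRAMING: a sub-lemma of the OPEN stub A; nothing here bears on P vs NP.
-/

set_option linter.dupNamespace false -- `Summit.PneNP.PneNP.…`: summit = sub-problem name (D-0017 single-conjunct layout)

namespace Summit.PneNP.PneNP.Theorems.NegLimitedAmplifiedWindow.Amp

open Finset
open Summit.PneNP.PneNP.Theorems.NegLimitedAmplifiedWindow (Restr leafWt rwt rbias qMoment biasSeq maj3 recMaj3)

/-! ### Signs and the majority of three -/

/-- `sgn (MAJ3 a b c) = (sa + sb + sc − sa·sb·sc)/2`. -/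
theorem sgn_maj3 (a b c : Bool) : sgn (maj3 a b c) = (sgn a + sgn b + sgn c - sgn a * sgn b * sgn c) / 2 := by
  cases a <;> cases b <;> cases c <;> simp [sgn, maj3] <;> norm_num

/-- Product sums over `Fin 3 → α` factor. -/
theorem sum_prod_three' {α : Type} [Fintype α] (f0 f1 f2 : α → ℝ) :
    ∑ σ : Fin 3 → α, f0 (σ 0) * f1 (σ 1) * f2 (σ 2) = (∑ a, f0 a) * (∑ a, f1 a) * (∑ a, f2 a) := by
  classical
  have h := (Finset.prod_univ_sum (fun _ : Fin 3 => (univ : Finset α))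
    (fun i a => (![f0, f1, f2] : Fin 3 → α → ℝ) i a))
  rw [Fintype.piFinset_univ, Fin.prod_univ_three] at h
  simp only [Matrix.cons_val_zero, Matrix.cons_val_one, Matrix.cons_val_two, Matrix.head_cons,
    Matrix.tail_cons] at h
  rw [h]
  refine sum_congr rfl fun σ _ => ?_
  rw [Fin.prod_univ_three]
  simp only [Matrix.cons_val_zero, Matrix.cons_val_one, Matrix.cons_val_two, Matrix.head_cons,
    Matrix.tail_cons]

/-- Splitting a function on the leaves of `RM3_{d+1}` into its three subtree functions. -/
def consSplit (β : Type) (d : ℕ) : ((Fin (d + 1) → Fin 3) → β) ≃ (Fin 3 → (Fin d → Fin 3) → β) where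
  toFun z := fun i w => z (Fin.cons i w)
  invFun σ := fun v => σ (v 0) (Fin.tail v)
  left_inv z := by funext v; simp only [Fin.cons_self_tail]
  right_inv σ := by funext i w; simp only [Fin.cons_zero, Fin.tail_cons]

/-! ### The true restricted bias and the recursive one agree -/

/-- The TRUE bias of `RM3_d` under the restriction `ρ` (free leaves uniform):
`2^{-3^d} Σ_z sgn RM3_d(w ↦ (ρ w).getD (z w))`. -/
noncomputable def rhoBias (d : ℕ) (ρ : Restr d) : ℝ :=
  ((2 : ℝ) ^ 3 ^ d)⁻¹ * ∑ z : (Fin d → Fin 3) → Bool, sgn (recMaj3 d fun w => (ρ w).getD (z w))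

/-- **Semantics of `rbias`**: the recursively computed bias IS the true restricted bias. -/
theorem rhoBias_eq_rbias : ∀ (d : ℕ) (ρ : Restr d), rhoBias d ρ = rbias d ρ
  | 0, ρ => by
    classical
    obtain ⟨o, ho⟩ : ∃ o, ∀ u, ρ u = o := ⟨ρ default, fun u => congrArg ρ (Subsingleton.elim _ _)⟩
    unfold rhoBias
    simp only [recMaj3, ho, pow_zero, pow_one]
    rw [Fintype.sum_equiv (Equiv.funUnique (Fin 0 → Fin 3) Bool)
      (fun z : (Fin 0 → Fin 3) → Bool => sgn (o.getD (z default))) (fun b => sgn (o.getD b))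
      (fun z => congrArg (fun u : Fin 0 → Fin 3 => sgn (o.getD (z u))) (Subsingleton.elim _ _)),
      Fintype.sum_bool]
    show _ = (ρ default).elim 0 (fun b => if b then 1 else -1)
    rw [ho]
    rcases o with _ | b
    · simp [sgn]
    · cases b <;> norm_num [sgn]
  | d + 1, ρ => by
    classical
    -- unfold one level on both sides
    rw [rbias, ← rhoBias_eq_rbias d, ← rhoBias_eq_rbias d, ← rhoBias_eq_rbias d]
    unfold rhoBias
    simp only [recMaj3]
    -- abbreviations for the subtree sign sums
    set M : ℝ := (2 : ℝ) ^ 3 ^ d with hM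
    have hM0 : M ≠ 0 := by positivity
    have hM3 : (2 : ℝ) ^ 3 ^ (d + 1) = M ^ 3 := by rw [hM, ← pow_mul, pow_succ]
    set s : Fin 3 → ((Fin d → Fin 3) → Bool) → ℝ :=
      fun i ζ => sgn (recMaj3 d fun w => (ρ (Fin.cons i w)).getD (ζ w)) with hs
    -- re-index `z` by its three subtree functions and expand `sgn ∘ maj3`
    have hsum : ∑ z : (Fin (d + 1) → Fin 3) → Bool, sgn (maj3
        (recMaj3 d fun w => (ρ (Matrix.vecCons 0 w)).getD (z (Matrix.vecCons 0 w)))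
        (recMaj3 d fun w => (ρ (Matrix.vecCons 1 w)).getD (z (Matrix.vecCons 1 w)))
        (recMaj3 d fun w => (ρ (Matrix.vecCons 2 w)).getD (z (Matrix.vecCons 2 w)))) =
        ∑ σ : Fin 3 → (Fin d → Fin 3) → Bool,
          (s 0 (σ 0) + s 1 (σ 1) + s 2 (σ 2) - s 0 (σ 0) * s 1 (σ 1) * s 2 (σ 2)) / 2 := by
      refine Fintype.sum_equiv (consSplit Bool d) _ _ fun z => ?_
      rw [sgn_maj3]
      rfl
    rw [hsum, hM3]
    simp only [sub_div, add_div, Finset.sum_sub_distrib, Finset.sum_add_distrib, ← Finset.sum_div]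
    have hcard : ∑ _ζ : (Fin d → Fin 3) → Bool, (1 : ℝ) = M := by
      simp only [Finset.sum_const, Finset.card_univ, Fintype.card_fun, Fintype.card_bool, Fintype.card_fin,
        nsmul_eq_mul, mul_one, Nat.cast_pow, Nat.cast_ofNat, hM]
    have h0 : ∑ σ : Fin 3 → (Fin d → Fin 3) → Bool, s 0 (σ 0) = (∑ ζ, s 0 ζ) * M * M := by
      rw [← hcard, ← sum_prod_three' (s 0) (fun _ => (1 : ℝ)) (fun _ => (1 : ℝ))]
      simp only [mul_one]
    have h1 : ∑ σ : Fin 3 → (Fin d → Fin 3) → Bool, s 1 (σ 1) = (∑ ζ, s 1 ζ) * M * M := by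
      rw [mul_comm (∑ ζ, s 1 ζ) M, ← hcard, ← sum_prod_three' (fun _ => (1 : ℝ)) (s 1) (fun _ => (1 : ℝ))]
      simp only [mul_one, one_mul]
    have h2 : ∑ σ : Fin 3 → (Fin d → Fin 3) → Bool, s 2 (σ 2) = (∑ ζ, s 2 ζ) * M * M := by
      rw [show (∑ ζ, s 2 ζ) * M * M = M * M * ∑ ζ, s 2 ζ by ring, ← hcard,
        ← sum_prod_three' (fun _ => (1 : ℝ)) (fun _ => (1 : ℝ)) (s 2)]
      simp only [one_mul]
    rw [h0, h1, h2, sum_prod_three' (s 0) (s 1) (s 2)]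
    simp only [hs]
    field_simp

/-- The restriction with free set `S` and fixed values `v`. -/
def toRestr {d : ℕ} (S : Finset (Fin d → Fin 3)) (v : (Fin d → Fin 3) → Bool) : Restr d :=
  fun w => if w ∈ S then none else some (v w)

/-- p3's `cbias (recMaj3 d) S v` is the true restricted bias of `toRestr S v`. -/
theorem cbias_eq_rhoBias {d : ℕ} (S : Finset (Fin d → Fin 3)) (v : (Fin d → Fin 3) → Bool) :
    cbias (recMaj3 d) S v = rhoBias d (toRestr S v) := by
  classical
  have hcard : Fintype.card (Fin d → Fin 3) = 3 ^ d := by simp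
  unfold cbias rhoBias
  rw [hcard]
  congr 1
  refine Finset.sum_congr rfl fun z _ => ?_
  congr 2
  funext w
  unfold toRestr
  split_ifs <;> rfl

/-! ### Re-indexing `(S, v) ↦ ρ` -/

/-- Indicator functions `W → Bool` versus finite sets. -/
def indicEquiv (W : Type) [Fintype W] [DecidableEq W] : (W → Bool) ≃ Finset W where
  toFun χ := univ.filter fun w => χ w = true
  invFun S := fun w => decide (w ∈ S)
  left_inv χ := by funext w; simp
  right_inv S := by ext w; simp

/-- The leaf code `Bool × Bool → Option Bool`: (free?, value) ↦ `none` / `some value`. -/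
def leafCode (c : Bool × Bool) : Option Bool := if c.1 then none else some c.2

/-- The leaf weight on codes: `p/2` for a free leaf (either phantom value), `(1−p)/2` for a fixed one. -/
noncomputable def leafCodeWt (p : ℝ) (c : Bool × Bool) : ℝ := if c.1 then p / 2 else (1 - p) / 2

/-- Fibre masses of the leaf code are the leaf weights of `NegLimitedAmplifiedWindowBiasMoments`. -/
theorem sum_leafCodeWt_fiber (p : ℝ) (o : Option Bool) :
    ∑ c ∈ (univ : Finset (Bool × Bool)).filter (fun c => leafCode c = o), leafCodeWt p c = leafWt p o := by
  rw [Finset.sum_filter, Fintype.sum_prod_type]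
  simp only [Fintype.sum_bool, leafCode, leafCodeWt, leafWt]
  rcases o with _ | b
  · simp
  · cases b <;> simp

/-- **Re-indexing**: p3's `expAbsBias` is the `rwt`-expectation of `|rbias|`. -/
theorem expAbsBias_eq_sum_rwt (d : ℕ) (p : ℝ) :
    expAbsBias d p = ∑ ρ : Restr d, rwt p ρ * |rbias d ρ| := by
  classical
  unfold expAbsBias
  -- Step 1: sets `S` as indicator functions, then pair up `(χ, v)` into `c : W → Bool × Bool`
  rw [← Fintype.sum_equiv (indicEquiv (Fin d → Fin 3)) (fun χ => ∑ v : (Fin d → Fin 3) → Bool,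
      (p / 2) ^ (indicEquiv _ χ).card * ((1 - p) / 2) ^ (3 ^ d - (indicEquiv _ χ).card) *
        |cbias (recMaj3 d) (indicEquiv _ χ) v|) _ (fun χ => rfl)]
  rw [← Fintype.sum_prod_type']
  rw [← Fintype.sum_equiv (Equiv.arrowProdEquivProdArrow (Fin d → Fin 3) (fun _ => Bool) (fun _ => Bool))
      (fun c => (p / 2) ^ (indicEquiv _ (fun w => (c w).1)).card *
        ((1 - p) / 2) ^ (3 ^ d - (indicEquiv _ (fun w => (c w).1)).card) *
          |cbias (recMaj3 d) (indicEquiv _ (fun w => (c w).1)) (fun w => (c w).2)|) _ (fun c => rfl)]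
  -- Step 2: identify the summand with `bw leafCodeWt c * |rhoBias (leafCode ∘ c)|`
  have hsummand : ∀ c : (Fin d → Fin 3) → Bool × Bool,
      (p / 2) ^ (indicEquiv _ (fun w => (c w).1)).card *
        ((1 - p) / 2) ^ (3 ^ d - (indicEquiv _ (fun w => (c w).1)).card) *
          |cbias (recMaj3 d) (indicEquiv _ (fun w => (c w).1)) (fun w => (c w).2)| =
      bw (fun _ => leafCodeWt p) c * |rbias d (fun w => leafCode (c w))| := by
    intro c
    have hS : ∀ w, w ∈ indicEquiv _ (fun w => (c w).1) ↔ (c w).1 = true := fun w => by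
      simp [indicEquiv]
    congr 1
    · -- the weight
      unfold bw leafCodeWt
      rw [Finset.prod_ite, Finset.prod_const, Finset.prod_const]
      have hc1 : (univ.filter fun w : Fin d → Fin 3 => (c w).1 = true) = indicEquiv _ (fun w => (c w).1) := by
        ext w; simp [indicEquiv]
      have hc2 : (univ.filter fun w : Fin d → Fin 3 => ¬(c w).1 = true).card =
          3 ^ d - (indicEquiv _ (fun w => (c w).1)).card := by
        have h := Finset.card_filter_add_card_filter_not
          (s := (univ : Finset (Fin d → Fin 3))) (fun w => (c w).1 = true)
        have hu : (univ : Finset (Fin d → Fin 3)).card = 3 ^ d := by simp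
        rw [hu, hc1] at h
        omega
      rw [hc1, hc2]
    · -- the bias
      rw [cbias_eq_rhoBias, rhoBias_eq_rbias]
      congr 2
      funext w
      simp only [toRestr, leafCode, hS]
  rw [Finset.sum_congr rfl fun c _ => hsummand c]
  have key := sum_bw_mul_comp (fun _ : Fin d → Fin 3 => leafCodeWt p) leafCode (fun ρ : Restr d => |rbias d ρ|)
  beta_reduce at key
  rw [key]
  refine Finset.sum_congr rfl fun ρ _ => ?_
  unfold rwt
  congr 1
  exact Finset.prod_congr rfl fun w _ => sum_leafCodeWt_fiber p (ρ w)

/-! ### The exponent -/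

/-- `√((13/16)^d) = (3^d)^{−α}` with `α = log₃(16/13)/2`. -/
theorem sqrt_pow_eq_rpow (d : ℕ) :
    Real.sqrt ((13 / 16 : ℝ) ^ d) = ((3 : ℝ) ^ d) ^ (-(Real.logb 3 (16 / 13) / 2)) := by
  have h3 : (0 : ℝ) ≤ 3 := by norm_num
  have hL : Real.logb 3 (13 / 16) = -Real.logb 3 (16 / 13) := by
    rw [show (13 / 16 : ℝ) = (16 / 13)⁻¹ by norm_num, Real.logb_inv]
  have h1316 : (13 / 16 : ℝ) = (3 : ℝ) ^ Real.logb 3 (13 / 16) :=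
    (Real.rpow_logb (by norm_num) (by norm_num) (by norm_num)).symm
  rw [Real.sqrt_eq_rpow, ← Real.rpow_natCast, ← Real.rpow_natCast, ← Real.rpow_mul (by norm_num),
    ← Real.rpow_mul h3, h1316, ← Real.rpow_mul h3, hL]
  congr 1
  ring

/-- **A7 `RM3BiasDecay`**, BY NAME. -/
theorem rm3BiasDecay_holds : RM3BiasDecay := by
  refine ⟨Real.logb 3 (16 / 13) / 2, ?_, ?_, fun p hp hp1 => ?_⟩
  · have := Real.logb_pos (b := 3) (by norm_num) (show (1 : ℝ) < 16 / 13 by norm_num)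
    linarith
  · have h1 : Real.logb 3 (16 / 13) < Real.logb 3 3 :=
      Real.logb_lt_logb (by norm_num) (by norm_num) (by norm_num)
    rw [Real.logb_self_eq_one (by norm_num)] at h1
    linarith
  obtain ⟨C, hC, hCd⟩ := biasSeq_decay hp hp1
  refine ⟨Real.sqrt C, Real.sqrt_pos.2 hC, fun d => ?_⟩
  calc expAbsBias d p = ∑ ρ : Restr d, rwt p ρ * |rbias d ρ| := expAbsBias_eq_sum_rwt d p
    _ ≤ Real.sqrt (qMoment p d) := sum_rwt_mul_abs_rbias_le hp.le hp1 d
    _ = Real.sqrt (biasSeq p d) := by rw [qMoment_eq_biasSeq]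
    _ ≤ Real.sqrt (C * (13 / 16) ^ d) := Real.sqrt_le_sqrt (hCd d)
    _ = Real.sqrt C * ((3 : ℝ) ^ d) ^ (-(Real.logb 3 (16 / 13) / 2)) := by
        rw [Real.sqrt_mul hC.le, sqrt_pow_eq_rpow]

end Summit.PneNP.PneNP.Theorems.NegLimitedAmplifiedWindow.Amp
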